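import Literature.RingTheory.KTheory.MilnorKRat
import Literature.RingTheory.KTheory.MilnorKModTwoReal
import HarnessLib

/-!
# The functor `k_n = K_n/2K_n` on ring homomorphisms, and THEOREM A.2 (Tate) for `F = ℚ`: `k_nℚ → k_nℝ` is an
# isomorphism for `n ≥ 3` (`k_nℚ ≅ k_nℝ ≅ ℤ/2`, generated by `l(−1)ⁿ`)
# (Milnor, *Algebraic K-theory and quadratic forms*, §1 Example 1.8 and Appendix Theorem A.2)

Family `hodge`, lane `lit-hodgefound` (foundations library; seat `lit-hodgefound-p27`, generation 52, row g52-#4);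
topic `RingTheory/KTheory`.  Sequel of `MilnorKModTwo` (g40-#9: `k_nR = MilnorK.Mod2 R n`, `kmk`, `kSymbol`),
`MilnorKGroupsFiniteField` (g39: the functor `MilnorK.map f : K_nR → K_nS`), `MilnorKRat` (g51-#4/#8: `K_nℚ ≅ ℤ/2` for
`n ≥ 3`, `two_zsmul_eq_zero`, `signHomOrd_injective`, `signHomOrd_map`) and `MilnorKModTwoReal` (g40-#11: `k_nℝ = {0, l(−1)ⁿ}`,
`kRealEquiv`).  DEFINITIONS WITH BODIES (`kMap` — the functor `k_n(f)`; `kmkRatEquiv`, `kRatEquiv`, `kRatRealEquiv` — the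
isomorphisms) and PROVED THEOREMS; no named fact, no instance, no notation, 0 `sorry`, net debt 0 (D-0026).

## The source, verbatim

J. Milnor, *Algebraic K-theory and quadratic forms*, Invent. Math. 9 (1970) 318–344 (held `paper:doi-10-1007-bf01425486`;
bib key `Milnor1970`), §1 Example 1.8 (p0005 L5–L29): «Let F be a global field […] The inclusions F → F_v induce a
homomorphism K₂F → ⊕_v K₂F_v/(max. divis. subgr.) […] The structure of K_nF is not known for n ≥ 3, but Tate has proved
the following partial result: The quotient K_nF/2K_nF maps isomorphically to the direct sum, over all real completions
F_v, of K_nF_v/2K_nF_v ≅ Z/2Z. Thus the dimension of K_nF/2K_nF as a mod 2 vector space is equal to the number of real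
completions. Tate's proof of this result is presented in the Appendix. It may be conjectured that the subgroup 2K_nF is
actually zero for n ≥ 3 […] As an example, for the field Q of rational numbers the isomorphism K_nQ ≅ Z/2Z for n ≥ 3 can
be established by methods similar to those of §2.3.»  Appendix (p0025 L4–L11): «**Theorem A.2 (Tate).** For n ≥ 3 the
natural homomorphism k_nF → ⊕ k_nF_v is an isomorphism. Here the group k_nF_v is cyclic of order 2 if F_v is the real
field, and is zero otherwise.»

## What is formalised

* §1 **The functor `k_n`**: a ring homomorphism `f : R → S` induces `kMap n f : k_nR → k_nS` (the tree's `MilnorK.map f`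
  passes to the quotients by `2K_n`), `{a₁,…,aₙ} ↦ {f a₁,…,f aₙ}` (`kMap_kSymbol`), `kMap_kmk`, `kMap_id`, `kMap_comp` —
  «the natural homomorphism k_nF → k_nF_v» «induced by inclusion».
* §2 **`k_nℚ` for `n ≥ 3`**: `2K_nℚ = 0` makes `K_nℚ → k_nℚ` an isomorphism (`kmk_rat_injective`, `kmkRatEquiv`), so
  `k_nℚ ≅ ℤ/2` (`kRatEquiv`, the sign character, `l(−1)ⁿ ↦ 1`) and `k_nℚ = {0, l(−1)ⁿ}` (`eq_zero_or_eq_kSymbol_neg_one_rat`).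
* §3 **THEOREM A.2 for `F = ℚ`** — whose only real completion is `ℝ`, so that «⊕ over all real completions» is `k_nℝ`:
  for `n ≥ 3` the natural map `k_nℚ → k_nℝ` is injective (`kMap_real_injective`: the sign character of `ℝ` restricts to
  that of `ℚ`), surjective (`kMap_real_surjective`: `k_nℝ` is generated by `l(−1)ⁿ`, which comes from `ℚ`), hence an
  isomorphism **`kRatRealEquiv k : k_{k+3}ℚ ≃+ k_{k+3}ℝ`** (`theoremA2_rat`), «cyclic of order 2» on both sides
  (`kRatEquiv`, the tree's `kRealEquiv`).  Not here: the vanishing of `k_nℚ_p` for the non-archimedean completions (Moore;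
  the tree has the prime-to-residue-characteristic part in `MilnorKLocalFieldModPrime`), global fields other than `ℚ`.

## References

* [Milnor1970] J. Milnor, *Algebraic K-theory and quadratic forms*, Invent. Math. 9 (1970) 318–344 — §1 Example 1.8
  (p. 322, p0005 L5–L29); Appendix, Theorem A.2 (p. 342, p0025 L4–L11).

Provenance: lane `lit-hodgefound`, seat `lit-hodgefound-p27` gen 52 (agent `literature-prover-lit-hodgefound-p27-g52-0`),
row g52-#4.
-/

set_option autoImplicit false

noncomputable section

namespace Literature.RingTheory.KTheory

namespace MilnorK

/-! ### §1 The functor `k_n`: `kMap n f : k_nR → k_nS` -/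

section Functor

variable {R S T : Type*} [CommRing R] [CommRing S] [CommRing T] (n : ℕ)

/-- `K_nR → K_nS` carries `2K_nR` into `2K_nS`. [cite: Milnor1970, §3 «k_nF = K_nF/2K_nF» (p0010 L27–L30)] -/
theorem twoMultiples_le_comap_map (f : R →+* S) : twoMultiples R n ≤ (twoMultiples S n).comap (map f) := by
  intro z hz
  obtain ⟨y, rfl⟩ := (mem_twoMultiples_iff R n).1 hz
  rw [AddSubgroup.mem_comap]
  exact (mem_twoMultiples_iff S n).2 ⟨map f y, by rw [map_zsmul]⟩

/-- **The functor `k_n` on a ring homomorphism** `f : R → S`: `kMap n f : k_nR → k_nS`, induced by `K_nR → K_nS` («the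
natural homomorphism k_nF → k_nF_v», «induced by inclusion»). [cite: Milnor1970, Appendix Theorem A.2 «the natural homomorphism k_nF → ⊕ k_nF_v» (p0025 L4–L7); Lemma A.1 «induced by inclusion» (p0024 L40)] -/
def kMap (f : R →+* S) : Mod2 R n →+ Mod2 S n :=
  QuotientAddGroup.map (twoMultiples R n) (twoMultiples S n) (map f) (twoMultiples_le_comap_map n f)

/-- `kMap` on the class of `z ∈ K_nR` is the class of `map f z`. [cite: Milnor1970, Appendix Theorem A.2 (p0025 L4–L7)] -/
theorem kMap_kmk (f : R →+* S) (z : MilnorK R n) : kMap n f (kmk R n z) = kmk S n (map f z) := rfl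

/-- **`kMap f {a₁, …, aₙ} = {f a₁, …, f aₙ}`.** [cite: Milnor1970, Appendix Theorem A.2 (p0025 L4–L7); §1 (p0001 L30–L36)] -/
theorem kMap_kSymbol (f : R →+* S) (a : Fin n → Rˣ) :
    kMap n f (kSymbol a) = kSymbol fun j => Units.map (f : R →* S) (a j) := by
  rw [kSymbol_def, kMap_kmk, map_symbol, kSymbol_def]

/-- `kMap id = id`. [cite: Milnor1970, §1 (p0001 L30–L33)] -/
theorem kMap_id : kMap n (RingHom.id R) = AddMonoidHom.id (Mod2 R n) :=
  mod2_hom_ext fun a => by rw [← kSymbol_def, kMap_kSymbol, AddMonoidHom.id_apply]; congr 1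

/-- `kMap g ∘ kMap f = kMap (g ∘ f)`. [cite: Milnor1970, §1 (p0001 L30–L33)] -/
theorem kMap_comp (f : R →+* S) (g : S →+* T) : (kMap n g).comp (kMap n f) = kMap n (g.comp f) :=
  mod2_hom_ext fun a => by
    rw [AddMonoidHom.comp_apply, ← kSymbol_def, kMap_kSymbol, kMap_kSymbol, kMap_kSymbol]
    congr 1

/-- `kMap f` is onto as soon as `K_nR → K_nS` is. [cite: Milnor1970, §3 «k_nF = K_nF/2K_nF» (p0010 L27–L30)] -/
theorem kMap_surjective_of_surjective (f : R →+* S) (hf : Function.Surjective (map f : MilnorK R n → MilnorK S n)) :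
    Function.Surjective (kMap n f) := by
  intro x
  obtain ⟨z, rfl⟩ := kmk_surjective x
  obtain ⟨y, rfl⟩ := hf z
  exact ⟨kmk R n y, kMap_kmk n f y⟩

end Functor

/-! ### §2 `k_nℚ ≅ ℤ/2` for `n ≥ 3` -/

section Rat

variable (k : ℕ)

/-- **`K_nℚ → k_nℚ` is injective for `n ≥ 3`** (`2K_nℚ = 0`, `two_zsmul_eq_zero`). [cite: Milnor1970, §1 Example 1.8 «K_nQ ≅ Z/2Z for n ≥ 3» and «the subgroup 2K_nF is actually zero» (p0005 L24–L29)] -/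
theorem kmk_rat_injective : Function.Injective (kmk ℚ (k + 3)) := by
  rw [injective_iff_map_eq_zero]
  intro z hz
  obtain ⟨y, rfl⟩ := kmk_eq_zero_iff.1 hz
  exact two_zsmul_eq_zero k y

/-- **`K_nℚ ≅ k_nℚ` for `n ≥ 3`.** [cite: Milnor1970, §1 Example 1.8 (p0005 L24–L29)] -/
def kmkRatEquiv : MilnorK ℚ (k + 3) ≃+ Mod2 ℚ (k + 3) :=
  AddEquiv.ofBijective (kmk ℚ (k + 3)) ⟨kmk_rat_injective k, kmk_surjective⟩

/-- `kmkRatEquiv` is the projection `kmk`. [cite: Milnor1970, §1 Example 1.8 (p0005 L24–L29)] -/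
@[simp] theorem kmkRatEquiv_apply (z : MilnorK ℚ (k + 3)) : kmkRatEquiv k z = kmk ℚ (k + 3) z := rfl

/-- **`k_nℚ ≅ ℤ/2ℤ` for `n ≥ 3`** (through `K_nℚ ≅ ℤ/2`, the sign character). [cite: Milnor1970, §1 Example 1.8 «the dimension of K_nF/2K_nF as a mod 2 vector space is equal to the number of real completions» (p0005 L21–L22); «K_nQ ≅ Z/2Z for n ≥ 3» (p0005 L26–L29)] -/
def kRatEquiv : Mod2 ℚ (k + 3) ≃+ ZMod 2 := (kmkRatEquiv k).symm.trans (equivZModTwo k)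

/-- `kRatEquiv` on a class is the sign character of a representative. [cite: Milnor1970, §1 Example 1.8 (p0005 L21–L29)] -/
theorem kRatEquiv_kmk (z : MilnorK ℚ (k + 3)) : kRatEquiv k (kmk ℚ (k + 3) z) = signHomOrd ℚ (k + 3) z := by
  rw [kRatEquiv, AddEquiv.trans_apply, ← kmkRatEquiv_apply, AddEquiv.symm_apply_apply, equivZModTwo_apply]

/-- The generator: `kRatEquiv (l(−1)ⁿ) = 1`. [cite: Milnor1970, §1 Example 1.8 (p0005 L26–L29); Example 1.6 (p0004 L13–L17)] -/
theorem kRatEquiv_kSymbol_neg_one : kRatEquiv k (kSymbol fun _ : Fin (k + 3) => (-1 : ℚˣ)) = 1 := by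
  rw [kSymbol_def, kRatEquiv_kmk, signHomOrd_symbol_neg_one]

/-- **`k_nℚ = {0, l(−1)ⁿ}` for `n ≥ 3`.** [cite: Milnor1970, §1 Example 1.8 (p0005 L26–L29)] -/
theorem eq_zero_or_eq_kSymbol_neg_one_rat (x : Mod2 ℚ (k + 3)) :
    x = 0 ∨ x = kSymbol (fun _ : Fin (k + 3) => (-1 : ℚˣ)) := by
  obtain ⟨z, rfl⟩ := kmk_surjective x
  obtain ⟨j, rfl⟩ := eq_zsmul_symbol_neg_one k z
  rcases Int.even_or_odd j with hj | hj
  · exact Or.inl (kmk_zsmul_even hj _)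
  · right
    obtain ⟨i, rfl⟩ := hj
    rw [add_zsmul, one_zsmul, map_add, kmk_zsmul_even (even_two_mul i), zero_add, kSymbol_def]

end Rat

/-! ### §3 THEOREM A.2 (Tate) for `F = ℚ`: `k_nℚ → k_nℝ` is an isomorphism for `n ≥ 3` -/

section TheoremA2

variable (k : ℕ)

/-- The embedding `ℚ → ℝ` is order-compatible (the hypothesis of `signHomOrd_map`). [folklore] -/
private theorem algebraMap_rat_real_nonneg_iff (x : ℚ) : 0 ≤ algebraMap ℚ ℝ x ↔ 0 ≤ x := by
  rw [eq_ratCast (algebraMap ℚ ℝ) x]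
  exact Rat.cast_nonneg

/-- **THEOREM A.2 for `ℚ`, injectivity: `k_nℚ → k_nℝ` is injective for `n ≥ 3`** — the sign character of `ℝ` restricts to
that of `ℚ` (`signHomOrd_map`), kills `2K_nℝ`, and is injective on `K_nℚ`. [cite: Milnor1970, Appendix Theorem A.2 (p0025 L4–L7); §1 Example 1.8 (p0005 L16–L20)] -/
theorem kMap_real_injective : Function.Injective (kMap (k + 3) (algebraMap ℚ ℝ)) := by
  rw [injective_iff_map_eq_zero]
  intro x hx
  obtain ⟨z, rfl⟩ := kmk_surjective x
  rw [kMap_kmk, kmk_eq_zero_iff] at hx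
  obtain ⟨y, hy⟩ := hx
  have h := signHomOrd_map (algebraMap ℚ ℝ) algebraMap_rat_real_nonneg_iff z
  rw [← hy, signHomOrd_two_zsmul] at h
  have hz : z = 0 := signHomOrd_injective k (by rw [← h, map_zero])
  rw [hz, map_zero]

/-- **THEOREM A.2 for `ℚ`, surjectivity: `k_nℚ → k_nℝ` is onto** — `k_nℝ = {0, l(−1)ⁿ}` and `l(−1)ⁿ` comes from `ℚ`.
[cite: Milnor1970, Appendix Theorem A.2 «k_nF_v is cyclic of order 2 if F_v is the real field» (p0025 L4–L10); §1 Example 1.6 (p0004 L13–L17)] -/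
theorem kMap_real_surjective : Function.Surjective (kMap (k + 3) (algebraMap ℚ ℝ)) := by
  intro x
  rcases eq_zero_or_eq_kSymbol_neg_one (k + 2) x with rfl | rfl
  · exact ⟨0, map_zero _⟩
  · refine ⟨kSymbol fun _ : Fin (k + 3) => (-1 : ℚˣ), ?_⟩
    rw [kMap_kSymbol]
    congr 1
    funext j
    exact Units.ext (by rw [Units.coe_map, MonoidHom.coe_coe, Units.val_neg, Units.val_one, map_neg, map_one,
      Units.val_neg, Units.val_one])

/-- **THEOREM A.2 (Tate) for `F = ℚ`.** «For n ≥ 3 the natural homomorphism k_nF → ⊕ k_nF_v is an isomorphism. Here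
the group k_nF_v is cyclic of order 2 if F_v is the real field, and is zero otherwise» — for `ℚ`, with its single real
completion: `k_nℚ → k_nℝ` is bijective for `n ≥ 3`. [cite: Milnor1970, Appendix Theorem A.2 (p0025 L4–L11); §1 Example 1.8 «maps isomorphically to the direct sum, over all real completions F_v, of K_nF_v/2K_nF_v ≅ Z/2Z» (p0005 L16–L20)] -/
theorem theoremA2_rat : Function.Bijective (kMap (k + 3) (algebraMap ℚ ℝ)) :=
  ⟨kMap_real_injective k, kMap_real_surjective k⟩

/-- **`k_nℚ ≅ k_nℝ` for `n ≥ 3`**, the natural map as an isomorphism. [cite: Milnor1970, Appendix Theorem A.2 (p0025 L4–L7); §1 Example 1.8 (p0005 L16–L20)] -/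
def kRatRealEquiv : Mod2 ℚ (k + 3) ≃+ Mod2 ℝ (k + 3) :=
  AddEquiv.ofBijective (kMap (k + 3) (algebraMap ℚ ℝ)) (theoremA2_rat k)

/-- `kRatRealEquiv` is `kMap`. [cite: Milnor1970, Appendix Theorem A.2 (p0025 L4–L7)] -/
@[simp] theorem kRatRealEquiv_apply (x : Mod2 ℚ (k + 3)) : kRatRealEquiv k x = kMap (k + 3) (algebraMap ℚ ℝ) x := rfl

/-- The isomorphism matches the generators: `l(−1)ⁿ ↦ l(−1)ⁿ`. [cite: Milnor1970, §1 Example 1.6 (p0004 L13–L17); Appendix Theorem A.2 (p0025 L9–L10)] -/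
theorem kRatRealEquiv_kSymbol_neg_one :
    kRatRealEquiv k (kSymbol fun _ : Fin (k + 3) => (-1 : ℚˣ)) = kSymbol fun _ : Fin (k + 3) => (-1 : ℝˣ) := by
  rw [kRatRealEquiv_apply, kMap_kSymbol]
  congr 1
  funext j
  exact Units.ext (by rw [Units.coe_map, MonoidHom.coe_coe, Units.val_neg, Units.val_one, map_neg, map_one,
    Units.val_neg, Units.val_one])

/-- **«the dimension of K_nF/2K_nF as a mod 2 vector space is equal to the number of real completions»** for `F = ℚ`
(one real completion): both `k_nℚ` and `k_nℝ` are `ℤ/2`, compatibly — the sign character of `k_nℝ` composed with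
`k_nℚ → k_nℝ` is the sign character of `k_nℚ`. [cite: Milnor1970, §1 Example 1.8 (p0005 L16–L22); Appendix Theorem A.2 (p0025 L4–L11)] -/
theorem kRealEquiv_kMap (x : Mod2 ℚ (k + 3)) : kRealEquiv (k + 2) (kMap (k + 3) (algebraMap ℚ ℝ) x) = kRatEquiv k x := by
  rcases eq_zero_or_eq_kSymbol_neg_one_rat k x with rfl | rfl
  · rw [map_zero, map_zero, map_zero]
  · rw [← kRatRealEquiv_apply, kRatRealEquiv_kSymbol_neg_one, kRealEquiv_kSymbol_neg_one, kRatEquiv_kSymbol_neg_one]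

/-- `k_nℚ` has exactly two elements for `n ≥ 3`. [cite: Milnor1970, §1 Example 1.8 (p0005 L21–L29)] -/
theorem natCard_mod2_rat : Nat.card (Mod2 ℚ (k + 3)) = 2 := by
  rw [Nat.card_congr (kRatEquiv k).toEquiv, Nat.card_zmod]

end TheoremA2

end MilnorK

end Literature.RingTheory.KTheory
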